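import Mathlib.Analysis.SpecialFunctions.SmoothTransition
import Mathlib.Analysis.Calculus.ContDiff.Deriv
import Mathlib.Analysis.Calculus.Deriv.Slope
import Mathlib.MeasureTheory.Integral.IntervalIntegral.FundThmCalculus
import HarnessLib

/-!
# The concave cut-off profile of Schoen–Yau's conformal factor

Schoen–Yau, Comm. Math. Phys. 65 (1979), §2, Step 1, p. 49, (2.2): *"For `t₀ > 0`, we define
`ζ(t)`, a `C⁵` function, satisfying `ζ(t) = t` for `t ≤ t₀`, `ζ(t) = 3t₀/2` for `t > 2t₀`,
`ζ'(t) ≥ 0` and `ζ''(t) ≤ 0` for all `t`"* — the profile through which the superharmonic function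
`-M/4r` is truncated to the constant `1 + ζ(∞)` near and inside the inner boundary of the end,
keeping `Δφ = ζ'(·)Δ(-M/4r) + ζ''(·)|∇(-M/4r)|² ≤ 0` ((2.3)).

This file constructs such a profile, of class `C^∞`, as the primitive of a smooth decreasing
cut-off:

* `concaveProfile t₀ t = ∫₀ᵗ (1 − S((s − t₀)/t₀)) ds` with `S = Real.smoothTransition`;
* `contDiff_concaveProfile`, `deriv_concaveProfile` (`ζ' = 1 − S((· − t₀)/t₀) ∈ [0, 1]`),
  `deriv_deriv_concaveProfile_nonpos` (`ζ'' ≤ 0`), `concaveProfile_of_le` (`ζ(t) = t` for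
  `t ≤ t₀`), `concaveProfile_of_ge` (`ζ(t) = ζ(2t₀)` for `t ≥ 2t₀`), `concaveProfile_nonneg`,
  `deriv_concaveProfile_of_le` (`ζ' = 1` below `t₀`), `deriv_concaveProfile_of_ge` (`ζ' = 0`
  above `2t₀`).

(The printed constant value `3t₀/2` is immaterial and is here `ζ(2t₀) ∈ [t₀, 2t₀]`; only
`ζ' ≥ 0`, `ζ'' ≤ 0`, linearity below `t₀` and constancy above `2t₀` are used in (2.3).)
Everything is proved; no statement of `Prop` type is introduced.

## References

* R. Schoen, S.-T. Yau, *On the proof of the positive mass conjecture in general relativity*,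
  Comm. Math. Phys. 65 (1979) 45–76, §2 Step 1, (2.2), p. 49. [SchoenYauPMT1979]
-/

noncomputable section

open Set Filter MeasureTheory intervalIntegral
open scoped Topology ContDiff

namespace Literature.Geometry.Lorentzian

namespace SchoenYau

/-- The smooth decreasing cut-off `χ(s) = 1 − S((s − t₀)/t₀)`: `χ = 1` on `s ≤ t₀`, `χ = 0` on
`s ≥ 2 t₀`, `0 ≤ χ ≤ 1` (`S` = `Real.smoothTransition`). [folklore] -/
def profileCutoff (t₀ s : ℝ) : ℝ :=
  1 - Real.smoothTransition ((s - t₀) / t₀)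

/-- **The concave profile** `ζ(t) = ∫₀ᵗ χ(s) ds` of Schoen–Yau 1979, (2.2) (a `C^∞` version).
[cite: SchoenYauPMT1979, §2 Step 1, (2.2) (p. 49)] -/
def concaveProfile (t₀ t : ℝ) : ℝ :=
  ∫ s in (0 : ℝ)..t, profileCutoff t₀ s

variable {t₀ : ℝ}

/-- The cut-off is smooth. [folklore] -/
theorem contDiff_profileCutoff (t₀ : ℝ) : ContDiff ℝ ∞ (profileCutoff t₀) :=
  contDiff_const.sub
    (Real.smoothTransition.contDiff.comp ((contDiff_id.sub contDiff_const).div_const _))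

/-- The cut-off is continuous. [folklore] -/
theorem continuous_profileCutoff (t₀ : ℝ) : Continuous (profileCutoff t₀) :=
  (contDiff_profileCutoff t₀).continuous

/-- `0 ≤ χ`. [folklore] -/
theorem profileCutoff_nonneg (t₀ s : ℝ) : 0 ≤ profileCutoff t₀ s :=
  sub_nonneg.2 (Real.smoothTransition.le_one _)

/-- `χ ≤ 1`. [folklore] -/
theorem profileCutoff_le_one (t₀ s : ℝ) : profileCutoff t₀ s ≤ 1 :=
  sub_le_self _ (Real.smoothTransition.nonneg _)

/-- `χ(s) = 1` for `s ≤ t₀` (`t₀ > 0`). [folklore] -/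
theorem profileCutoff_of_le (ht₀ : 0 < t₀) {s : ℝ} (hs : s ≤ t₀) : profileCutoff t₀ s = 1 := by
  rw [profileCutoff, Real.smoothTransition.zero_of_nonpos, sub_zero]
  exact div_nonpos_of_nonpos_of_nonneg (by linarith) ht₀.le

/-- `χ(s) = 0` for `s ≥ 2 t₀` (`t₀ > 0`). [folklore] -/
theorem profileCutoff_of_ge (ht₀ : 0 < t₀) {s : ℝ} (hs : 2 * t₀ ≤ s) : profileCutoff t₀ s = 0 := by
  rw [profileCutoff, Real.smoothTransition.one_of_one_le, sub_self]
  rw [le_div_iff₀ ht₀]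
  linarith

/-- The cut-off is decreasing (`t₀ > 0`). [folklore] -/
theorem antitone_profileCutoff (ht₀ : 0 < t₀) : Antitone (profileCutoff t₀) := by
  intro s₁ s₂ h
  simp only [profileCutoff]
  have : (s₁ - t₀) / t₀ ≤ (s₂ - t₀) / t₀ := div_le_div_of_nonneg_right (by linarith) ht₀.le
  linarith [Real.smoothTransition.monotone this]

/-- `χ' ≤ 0`. [folklore] -/
theorem deriv_profileCutoff_nonpos (ht₀ : 0 < t₀) (s : ℝ) : deriv (profileCutoff t₀) s ≤ 0 :=
  (antitone_profileCutoff ht₀).deriv_nonpos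

/-- **FTC for the profile**: `ζ` has derivative `χ(t)` at `t`. [folklore] -/
theorem hasDerivAt_concaveProfile (t₀ t : ℝ) :
    HasDerivAt (concaveProfile t₀) (profileCutoff t₀ t) t :=
  ((continuous_profileCutoff t₀).integral_hasStrictDerivAt 0 t).hasDerivAt

/-- `ζ' = χ`. [folklore] -/
theorem deriv_concaveProfile (t₀ : ℝ) : deriv (concaveProfile t₀) = profileCutoff t₀ :=
  funext fun t ↦ (hasDerivAt_concaveProfile t₀ t).deriv

/-- `ζ` is differentiable. [folklore] -/
theorem differentiable_concaveProfile (t₀ : ℝ) : Differentiable ℝ (concaveProfile t₀) :=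
  fun t ↦ (hasDerivAt_concaveProfile t₀ t).differentiableAt

/-- **The profile is `C^∞`** (its derivative is the smooth cut-off). [folklore] -/
theorem contDiff_concaveProfile (t₀ : ℝ) : ContDiff ℝ ∞ (concaveProfile t₀) :=
  contDiff_infty_iff_deriv.2
    ⟨differentiable_concaveProfile t₀, by rw [deriv_concaveProfile]; exact contDiff_profileCutoff t₀⟩

/-- `0 ≤ ζ'`. [cite: SchoenYauPMT1979, §2 Step 1, (2.2) (p. 49)] -/
theorem deriv_concaveProfile_nonneg (t₀ t : ℝ) : 0 ≤ deriv (concaveProfile t₀) t := by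
  rw [deriv_concaveProfile]
  exact profileCutoff_nonneg t₀ t

/-- `ζ' ≤ 1`. [folklore] -/
theorem deriv_concaveProfile_le_one (t₀ t : ℝ) : deriv (concaveProfile t₀) t ≤ 1 := by
  rw [deriv_concaveProfile]
  exact profileCutoff_le_one t₀ t

/-- **`ζ'' ≤ 0`** (`t₀ > 0`). [cite: SchoenYauPMT1979, §2 Step 1, (2.2) (p. 49)] -/
theorem deriv_deriv_concaveProfile_nonpos (ht₀ : 0 < t₀) (t : ℝ) :
    deriv (deriv (concaveProfile t₀)) t ≤ 0 := by
  rw [deriv_concaveProfile]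
  exact deriv_profileCutoff_nonpos ht₀ t

/-- `ζ' = 1` below `t₀` (`t₀ > 0`). [folklore] -/
theorem deriv_concaveProfile_of_le (ht₀ : 0 < t₀) {t : ℝ} (ht : t ≤ t₀) :
    deriv (concaveProfile t₀) t = 1 := by
  rw [deriv_concaveProfile, profileCutoff_of_le ht₀ ht]

/-- `ζ' = 0` above `2 t₀` (`t₀ > 0`). [folklore] -/
theorem deriv_concaveProfile_of_ge (ht₀ : 0 < t₀) {t : ℝ} (ht : 2 * t₀ ≤ t) :
    deriv (concaveProfile t₀) t = 0 := by
  rw [deriv_concaveProfile, profileCutoff_of_ge ht₀ ht]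

/-- `ζ'' = 0` below `t₀` (`t₀ > 0`): there `ζ'` is locally the constant `1`. [folklore] -/
theorem deriv_deriv_concaveProfile_of_lt (ht₀ : 0 < t₀) {t : ℝ} (ht : t < t₀) :
    deriv (deriv (concaveProfile t₀)) t = 0 := by
  rw [deriv_concaveProfile]
  have h : profileCutoff t₀ =ᶠ[𝓝 t] fun _ ↦ (1 : ℝ) :=
    (eventually_lt_nhds ht).mono fun s hs ↦ profileCutoff_of_le ht₀ hs.le
  rw [h.deriv_eq, deriv_const]

/-- **`ζ(t) = t` for `t ≤ t₀`** (`t₀ > 0`). [cite: SchoenYauPMT1979, §2 Step 1, (2.2) (p. 49)] -/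
theorem concaveProfile_of_le (ht₀ : 0 < t₀) {t : ℝ} (ht : t ≤ t₀) : concaveProfile t₀ t = t := by
  rw [concaveProfile]
  have h : EqOn (profileCutoff t₀) (fun _ ↦ (1 : ℝ)) (uIcc 0 t) := fun s hs ↦ by
    refine profileCutoff_of_le ht₀ ?_
    rcases mem_uIcc.1 hs with ⟨-, h2⟩ | ⟨-, h2⟩
    · exact h2.trans ht
    · exact h2.trans ht₀.le
  rw [integral_congr h, intervalIntegral.integral_const, smul_eq_mul, mul_one, sub_zero]

/-- **`ζ` is constant above `2 t₀`**: `ζ(t) = ζ(2t₀)` for `t ≥ 2 t₀` (`t₀ > 0`).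
[cite: SchoenYauPMT1979, §2 Step 1, (2.2) (p. 49)] -/
theorem concaveProfile_of_ge (ht₀ : 0 < t₀) {t : ℝ} (ht : 2 * t₀ ≤ t) :
    concaveProfile t₀ t = concaveProfile t₀ (2 * t₀) := by
  simp only [concaveProfile]
  have hi : ∀ a b : ℝ, IntervalIntegrable (profileCutoff t₀) volume a b := fun a b ↦
    (continuous_profileCutoff t₀).intervalIntegrable a b
  rw [← integral_add_adjacent_intervals (hi 0 (2 * t₀)) (hi (2 * t₀) t)]
  have h0 : EqOn (profileCutoff t₀) (fun _ ↦ (0 : ℝ)) (uIcc (2 * t₀) t) := fun s hs ↦ by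
    refine profileCutoff_of_ge ht₀ ?_
    rcases mem_uIcc.1 hs with ⟨h1, -⟩ | ⟨h1, -⟩
    · exact h1
    · exact ht.trans h1
  rw [integral_congr h0, intervalIntegral.integral_zero, add_zero]

/-- `ζ ≥ 0` on `[0, ∞)`. [folklore] -/
theorem concaveProfile_nonneg (t₀ : ℝ) {t : ℝ} (ht : 0 ≤ t) : 0 ≤ concaveProfile t₀ t :=
  integral_nonneg ht fun s _ ↦ profileCutoff_nonneg t₀ s

/-- `ζ(0) = 0`. [folklore] -/
theorem concaveProfile_zero (t₀ : ℝ) : concaveProfile t₀ 0 = 0 :=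
  integral_same

/-- `ζ(t) ≤ t` on `[0, ∞)` (`ζ' ≤ 1`). [folklore] -/
theorem concaveProfile_le_self (t₀ : ℝ) {t : ℝ} (ht : 0 ≤ t) : concaveProfile t₀ t ≤ t := by
  have h1 : IntervalIntegrable (fun _ : ℝ ↦ (1 : ℝ)) volume 0 t :=
    (continuous_const (y := (1 : ℝ))).intervalIntegrable 0 t
  have h := integral_mono_on ht ((continuous_profileCutoff t₀).intervalIntegrable 0 t) h1
    fun s _ ↦ profileCutoff_le_one t₀ s
  rw [intervalIntegral.integral_const, smul_eq_mul, mul_one, sub_zero] at h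
  exact h

end SchoenYau

end Literature.Geometry.Lorentzian

end
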